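import Mathlib
import Summits.MatrixMultiplication.MatrixMultiplication.Theorems.SnSubsetDichotomyHyperoctahedralThresholdStubSameColourSupply

/-!
# Hot reflection rungs are few under POOR (crux `HyperoctahedralThreshold`, open core `stub_poorRigidCore`; siege k9)

Brick 5b of the dart-level bookkeeping (memo `memo-k9-dart-bookkeeping.md` §2 (B5), evidence on stmt-MatrixMultiplication-10883): the
hot-rung cap `H` of `stub_configProductBounds` (p117303) is not a hypothesis on the host — the points carrying a reflection rung of
multiplicity `> H` at radius `s` are few, by a SECOND MOMENT that POOR pays:

* `card_reflTriples_le` — the triples `(P, α, α')`, `α ≠ α'` reduced of length `s` with first letter `≠ c`, whose reflection partners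
  agree, `P·ι_α = P·ι_{α'}` (`P·ι_α := P·α⁻¹·c·α`), number at most `|W_s|² · Φ` when every nonempty reduced word of length `≤ 4s+2` has
  `≤ Φ` fixed points: for a fixed pair `(α, α')` with longest common suffix of length `i`, `P ↦ Q := P·α⁻¹` carries the fibre into the
  fixed points of the reduced word `G' c G'⁻¹ c`, `G' := α_[s-i] · (α'_[s-i])⁻¹` — two reflection words colliding at `P` ARE a same-colour
  structure at `Q` (lead c3's `collision_structure`, p112303).
* `card_hot_mul_le` — `H(H+1) · #hot ≤ #triples` for any set `hot` of points each carrying some `Z` with `> H` words `α`, `P·ι_α = Z`.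
* `stub_hotRungExcision` — both together: `H(H+1) · #hot ≤ 2^s · 2^s · Φ`.  With `H_s = 2^s/(DΛ)` the excision of darts through hot
  points costs `≤ 2k · 2^k · Φ · D²Λ²` (memo §2), affordable for `Φ = n^{3/4+o(1)}`.

Pure finite combinatorics; no definitions; reuses `collision_structure`, `exists_step`, `card_redWords`, `foldl_act_reverse`,
`foldl_act_injective`, `mem_words` of p112303.
-/

set_option linter.dupNamespace false

namespace Summit.MatrixMultiplication.MatrixMultiplication.Theorems.HyperoctahedralThreshold.HotRungs

open Finset
open Summit.MatrixMultiplication.MatrixMultiplication.Theorems.HyperoctahedralThreshold.Supply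

variable {n : ℕ}

/-- A same-colour structure word gives a reduced closed word: for `G'` reduced, nonempty, with first and last letter `≠ c`, the word
`G' c G'⁻¹ c` is reduced, and `Q` is one of its fixed points iff `μ c (Q·G') = (μ c Q)·G'`. -/
theorem structure_word (μ : Fin 3 → Equiv.Perm (Fin n)) (hμ : ∀ b, μ b * μ b = 1) (c : Fin 3) {G' : List (Fin 3)}
    (hne : G' ≠ []) (hch : List.IsChain (· ≠ ·) G') (hh : G'.head? ≠ some c) (hl : G'.getLast? ≠ some c) :
    List.IsChain (· ≠ ·) (G' ++ c :: (G'.reverse ++ [c])) ∧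
    ∀ Q : Fin n, μ c (G'.foldl (fun v b => μ b v) Q) = G'.foldl (fun v b => μ b v) (μ c Q) →
      (G' ++ c :: (G'.reverse ++ [c])).foldl (fun v b => μ b v) Q = Q := by
  constructor
  · rw [List.isChain_append]
    refine ⟨hch, ?_, ?_⟩
    · rw [List.isChain_cons]
      refine ⟨?_, ?_⟩
      · intro y hy
        rw [List.head?_append_of_ne_nil _ (List.reverse_ne_nil_iff.2 hne), List.head?_reverse] at hy
        exact fun hcy => hl (by rw [hcy]; exact Option.mem_def.1 hy)
      · rw [List.isChain_append]
        refine ⟨?_, List.isChain_singleton _, ?_⟩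
        · rw [List.isChain_reverse]
          exact hch.imp (fun a b hab => Ne.symm hab)
        · intro x hx y hy
          rw [List.getLast?_reverse] at hx
          rw [List.head?_cons, Option.mem_def, Option.some.injEq] at hy
          rw [← hy]
          exact fun hxc => hh (by rw [← hxc]; exact Option.mem_def.1 hx)
    · intro x hx y hy
      rw [List.head?_cons, Option.mem_def, Option.some.injEq] at hy
      rw [← hy]
      exact fun hxc => hl (by rw [← hxc]; exact Option.mem_def.1 hx)
  · intro Q hQ
    rw [List.foldl_append, List.foldl_cons, hQ, List.foldl_append, foldl_act_reverse μ hμ, List.foldl_cons,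
      List.foldl_nil]
    have h2 : (μ c * μ c) Q = Q := by rw [hμ c]; rfl
    simpa using h2

/-- **Agreeing reflection words are few.**  The triples `(P, α, α')`, `α ≠ α'` reduced of length `s` with first letter `≠ c`, with
`P·ι_α = P·ι_{α'}`, number at most `|W_s|²·Φ` (`Φ` bounding the fixed points of nonempty reduced words of length `≤ 4s+2`). -/
theorem card_reflTriples_le (μ : Fin 3 → Equiv.Perm (Fin n)) (hμ : ∀ b, μ b * μ b = 1) (c : Fin 3) (s Φ : ℕ)
    (hΦ : ∀ w : List (Fin 3), w ≠ [] → List.IsChain (· ≠ ·) w → w.length ≤ 4 * s + 2 → ((Finset.univ : Finset (Fin n)).filter (fun x => w.foldl (fun v b => μ b v) x = x)).card ≤ Φ) :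
    ((((Finset.univ : Finset (Fin n)) ×ˢ (((Finset.univ : Finset (List.Vector (Fin 3) s)).image (fun v => v.toList)).filter (fun g => List.IsChain (· ≠ ·) g ∧ g.head? ≠ some c))) ×ˢ (((Finset.univ : Finset (List.Vector (Fin 3) s)).image (fun v => v.toList)).filter (fun g => List.IsChain (· ≠ ·) g ∧ g.head? ≠ some c))).filter (fun t => t.1.2 ≠ t.2 ∧ ((t.1.2).reverse ++ c :: t.1.2).foldl (fun v b => μ b v) t.1.1 = ((t.2).reverse ++ c :: t.2).foldl (fun v b => μ b v) t.1.1)).card ≤ Φ * ((((Finset.univ : Finset (List.Vector (Fin 3) s)).image (fun v => v.toList)).filter (fun g => List.IsChain (· ≠ ·) g ∧ g.head? ≠ some c)).card * (((Finset.univ : Finset (List.Vector (Fin 3) s)).image (fun v => v.toList)).filter (fun g => List.IsChain (· ≠ ·) g ∧ g.head? ≠ some c)).card) := by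
  set W := (((Finset.univ : Finset (List.Vector (Fin 3) s)).image (fun v => v.toList)).filter (fun g => List.IsChain (· ≠ ·) g ∧ g.head? ≠ some c)) with hW
  have memW : ∀ g ∈ W, g.length = s ∧ List.IsChain (· ≠ ·) g ∧ g.head? ≠ some c := by
    intro g hg
    rw [hW, Finset.mem_filter, mem_words] at hg
    exact hg
  set φ : (Fin n × List (Fin 3)) × List (Fin 3) → List (Fin 3) × List (Fin 3) := fun t => (t.1.2, t.2) with hφ
  refine (Finset.card_le_mul_card_image (f := φ) _ Φ ?_).trans (Nat.mul_le_mul_left _ ?_)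
  · -- the fibre over `(α, α')`: `P ↦ P·α⁻¹` into the fixed points of the structure word of the colliding pair
    intro q hq
    obtain ⟨t₀, ht₀, rfl⟩ := Finset.mem_image.1 hq
    rw [Finset.mem_filter, Finset.mem_product, Finset.mem_product] at ht₀
    obtain ⟨⟨⟨-, hα⟩, hα'⟩, hne, he₀⟩ := ht₀
    obtain ⟨hl₁, hc₁, hh₁⟩ := memW _ hα
    obtain ⟨hl₂, hc₂, hh₂⟩ := memW _ hα'
    -- longest common suffix
    obtain ⟨i, his, hPi, hnP⟩ := exists_step (P := fun j => t₀.1.2.drop (s - j) = t₀.2.drop (s - j)) s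
      (by
        show t₀.1.2.drop (s - 0) = t₀.2.drop (s - 0)
        rw [Nat.sub_zero, List.drop_of_length_le (by rw [hl₁]), List.drop_of_length_le (by rw [hl₂])])
      (by
        show ¬ t₀.1.2.drop (s - s) = t₀.2.drop (s - s)
        rw [Nat.sub_self, List.drop_zero, List.drop_zero]
        exact hne)
    -- colliding darts from any `P` in the fibre: `(P·α⁻¹, α)` and `(P·α'⁻¹, α')`
    have coll : ∀ P : Fin n, (t₀.1.2.reverse ++ c :: t₀.1.2).foldl (fun v b => μ b v) P = (t₀.2.reverse ++ c :: t₀.2).foldl (fun v b => μ b v) P →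
        t₀.1.2.foldl (fun v b => μ b v) ((t₀.1.2.reverse).foldl (fun v b => μ b v) P) = t₀.2.foldl (fun v b => μ b v) ((t₀.2.reverse).foldl (fun v b => μ b v) P) ∧
        t₀.1.2.foldl (fun v b => μ b v) (μ c ((t₀.1.2.reverse).foldl (fun v b => μ b v) P)) =
          t₀.2.foldl (fun v b => μ b v) (μ c ((t₀.2.reverse).foldl (fun v b => μ b v) P)) := by
      intro P he
      constructor
      · have e1 := foldl_act_reverse μ hμ t₀.1.2.reverse P
        have e2 := foldl_act_reverse μ hμ t₀.2.reverse P
        rw [List.reverse_reverse] at e1 e2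
        rw [e1, e2]
      · rw [List.foldl_append, List.foldl_cons, List.foldl_append, List.foldl_cons] at he
        exact he
    set G' := t₀.1.2.take (s - i) ++ (t₀.2.take (s - i)).reverse with hG'
    obtain ⟨H1, H2, H3, H4, -, -⟩ := collision_structure μ hμ c his hl₁ hl₂ hc₁ hc₂ hh₁ hh₂
      (coll t₀.1.1 he₀).1 (coll t₀.1.1 he₀).2 hPi hnP
    rw [← hG'] at H1 H2 H3 H4
    have hG'ne : G' ≠ [] := List.ne_nil_of_length_pos (by rw [H1]; omega)
    obtain ⟨hwc, hwfix⟩ := structure_word μ hμ c hG'ne H2 H3 H4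
    refine le_trans ?_ (hΦ (G' ++ c :: (G'.reverse ++ [c])) (by simp) hwc ?_)
    · refine Finset.card_le_card_of_injOn (fun t => (t.1.2.reverse).foldl (fun v b => μ b v) t.1.1) ?_ ?_
      · intro t ht
        rw [Finset.mem_coe, Finset.mem_filter, Finset.mem_filter, Finset.mem_product, Finset.mem_product] at ht
        obtain ⟨⟨⟨⟨-, -⟩, -⟩, -, he⟩, hproj⟩ := ht
        simp only [hφ, Prod.mk.injEq] at hproj
        obtain ⟨h1, h2⟩ := hproj
        rw [Finset.mem_coe, Finset.mem_filter]
        refine ⟨Finset.mem_univ _, ?_⟩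
        dsimp only
        rw [h1, h2] at he
        rw [h1]
        obtain ⟨-, -, -, -, H5, H6⟩ := collision_structure μ hμ c his hl₁ hl₂ hc₁ hc₂ hh₁ hh₂
          (coll t.1.1 he).1 (coll t.1.1 he).2 hPi hnP
        rw [← hG'] at H5 H6
        refine hwfix _ ?_
        rw [H5, H6]
      · intro t ht t' ht' htt'
        rw [Finset.mem_coe, Finset.mem_filter] at ht ht'
        have e := ht.2.trans ht'.2.symm
        simp only [hφ, Prod.mk.injEq] at e
        obtain ⟨e1, e2⟩ := e
        dsimp only at htt'
        rw [e1] at htt'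
        have hP : t.1.1 = t'.1.1 := foldl_act_injective μ hμ _ htt'
        exact Prod.ext (Prod.ext hP e1) e2
    · clear_value G'
      have hlen : (G' ++ c :: (G'.reverse ++ [c])).length = 2 * G'.length + 2 := by
        simp only [List.length_append, List.length_cons, List.length_reverse, List.length_nil]
        omega
      rw [hlen, H1]
      omega
  · -- the image lies in `W × W`
    refine Finset.card_le_card_of_injOn id ?_ (Set.injOn_id _) |>.trans (le_of_eq (Finset.card_product _ _))
    intro q hq
    obtain ⟨t, ht, rfl⟩ := Finset.mem_image.1 (Finset.mem_coe.1 hq)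
    rw [Finset.mem_filter, Finset.mem_product, Finset.mem_product] at ht
    obtain ⟨⟨⟨-, hα⟩, hα'⟩, -, -⟩ := ht
    rw [Finset.mem_coe]
    exact Finset.mem_product.2 ⟨hα, hα'⟩

/-- **Hot points carry many agreeing pairs.**  If every `P ∈ hot` has some `Z` with more than `H` words `α` (reduced, length `s`, first
letter `≠ c`) such that `P·ι_α = Z`, then `H(H+1)·|hot| ≤ #triples` (ordered pairs of distinct such words at each hot point). -/
theorem card_hot_mul_le (μ : Fin 3 → Equiv.Perm (Fin n)) (c : Fin 3) (s H : ℕ) (hot : Finset (Fin n))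
    (hhot : ∀ P ∈ hot, ∃ Z : Fin n, H < ((((Finset.univ : Finset (List.Vector (Fin 3) s)).image (fun v => v.toList)).filter (fun g => List.IsChain (· ≠ ·) g ∧ g.head? ≠ some c)).filter (fun α => ((α).reverse ++ c :: α).foldl (fun v b => μ b v) P = Z)).card) :
    H * (H + 1) * hot.card ≤ ((((Finset.univ : Finset (Fin n)) ×ˢ (((Finset.univ : Finset (List.Vector (Fin 3) s)).image (fun v => v.toList)).filter (fun g => List.IsChain (· ≠ ·) g ∧ g.head? ≠ some c))) ×ˢ (((Finset.univ : Finset (List.Vector (Fin 3) s)).image (fun v => v.toList)).filter (fun g => List.IsChain (· ≠ ·) g ∧ g.head? ≠ some c))).filter (fun t => t.1.2 ≠ t.2 ∧ ((t.1.2).reverse ++ c :: t.1.2).foldl (fun v b => μ b v) t.1.1 = ((t.2).reverse ++ c :: t.2).foldl (fun v b => μ b v) t.1.1)).card := by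
  classical
  set W := (((Finset.univ : Finset (List.Vector (Fin 3) s)).image (fun v => v.toList)).filter (fun g => List.IsChain (· ≠ ·) g ∧ g.head? ≠ some c)) with hW
  choose! Zf hZf using hhot
  set A : Fin n → Finset (List (Fin 3)) := fun P => W.filter (fun α => ((α).reverse ++ c :: α).foldl (fun v b => μ b v) P = Zf P) with hA
  calc H * (H + 1) * hot.card = ∑ P ∈ hot, H * (H + 1) := by rw [Finset.sum_const, smul_eq_mul, Nat.mul_comm]
    _ ≤ ∑ P ∈ hot, ((A P).offDiag).card := by
        refine Finset.sum_le_sum (fun P hP => ?_)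
        have ha : H + 1 ≤ (A P).card := hZf P hP
        rw [Finset.offDiag_card]
        calc H * (H + 1) ≤ ((A P).card - 1) * (A P).card := Nat.mul_le_mul (by omega) ha
          _ = (A P).card * (A P).card - (A P).card := Nat.sub_one_mul _ _
    _ = (hot.sigma (fun P => (A P).offDiag)).card := (Finset.card_sigma _ _).symm
    _ ≤ _ := by
        refine Finset.card_le_card_of_injOn (fun x => ((x.1, x.2.1), x.2.2)) ?_ ?_
        · intro x hx
          rw [Finset.mem_coe, Finset.mem_sigma, Finset.mem_offDiag] at hx
          obtain ⟨hP, h1, h2, hne⟩ := hx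
          rw [hA, Finset.mem_filter] at h1 h2
          rw [Finset.mem_coe, Finset.mem_filter, Finset.mem_product, Finset.mem_product]
          exact ⟨⟨⟨Finset.mem_univ _, h1.1⟩, h2.1⟩, hne, h1.2.trans h2.2.symm⟩
        · intro x _ y _ hxy
          simp only [Prod.mk.injEq] at hxy
          obtain ⟨⟨h1, h2⟩, h3⟩ := hxy
          exact Sigma.ext h1 (heq_of_eq (Prod.ext h2 h3))

/-- **Registered form** (`stub_hotRungExcision`, a `--supports` sub-goal of crux `stmt-MatrixMultiplication-10883`, helper for the
open core `stub_poorRigidCore`): hot reflection rungs are few — `H(H+1) · |hot| ≤ Φ · (2^s · 2^s)` for any set `hot` of points carrying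
a reflection rung of multiplicity `> H` at radius `s`, `Φ` bounding the fixed points of nonempty reduced words of length `≤ 4s+2`
(`card_hot_mul_le` + `card_reflTriples_le` + `card_redWords`).  Under the core's POOR (`stub_poorUniform`, p116729) `Φ = n^{3/4+o(1)}`,
so with `H_s = 2^s/(DΛ)` the dart-level excision of hot points costs `o(n·2^k)` (memo §2 (B5)): the cap `H` of
`stub_configProductBounds` (p117303) is prepaid by POOR. -/
theorem stub_hotRungExcision : ∀ (n s Φ H : ℕ) (μ : Fin 3 → Equiv.Perm (Fin n)) (c : Fin 3) (hot : Finset (Fin n)), (∀ b, μ b * μ b = 1) → (∀ w : List (Fin 3), w ≠ [] → List.IsChain (· ≠ ·) w → w.length ≤ 4 * s + 2 → ((Finset.univ : Finset (Fin n)).filter (fun x => w.foldl (fun v b => μ b v) x = x)).card ≤ Φ) → (∀ P ∈ hot, ∃ Z : Fin n, H < ((((Finset.univ : Finset (List.Vector (Fin 3) s)).image (fun v => v.toList)).filter (fun g => List.IsChain (· ≠ ·) g ∧ g.head? ≠ some c)).filter (fun α => ((α).reverse ++ c :: α).foldl (fun v b => μ b v) P = Z)).card) → H * (H + 1) * hot.card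 ≤ Φ * (2 ^ s * 2 ^ s) := by
  intro n s Φ H μ c hot hμ hΦ hhot
  have h1 := card_hot_mul_le μ c s H hot hhot
  have h2 := card_reflTriples_le μ hμ c s Φ hΦ
  rw [card_redWords s c] at h2
  exact h1.trans h2

end Summit.MatrixMultiplication.MatrixMultiplication.Theorems.HyperoctahedralThreshold.HotRungs
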